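import Summits.Ventures.HodgeRepro2.A2PontryaginLefschetz

/-!
# The Pontryagin product with a full-plane monomial is a plane contraction (A2 annex, operator identity — part 11)

**Theorem** (`pontryagin_ET`): in the twelve-plane model, for every class `z` and every set `T` of
planes, `z ⋆ E_T = vol • Λ_{univ ∖ T} z` — the Pontryagin product with the full-plane monomial
`E_T = ∏_{p ∈ T} E_p` is the contraction along the complementary planes.  By linearity the
Pontryagin product with any element `x = Σ_T a_T E_T` of the subalgebra generated by the `E_p` is
the constant-coefficient operator `Σ_T a_T vol • Λ_{T^c}` (`pontryagin_sum_ET`), and for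
`x = θ^k = k! Σ_{|T| = k} c_T E_T` (p5's `theta_pow`) this is the operator identity of
`A2PontryaginLefschetz` again (`pontryagin_theta_pow_eq_sum`).  The proof is the one of the operator
identity with `E_T` in place of `θ^k`: the half-plane tensors are killed, the main part pairs to
`∫_B z ∧ (u∖S) · ∫_B E_T ∧ E_S = vol · [S = univ ∖ T] · ∫_B z ∧ (u∖S)`, and `Λ_S` is self-adjoint.
-/

namespace Summit.Ventures.HodgeRepro2.A2PontryaginFullPlane

open WeilPlanes WeilIntegral WeilDetect WeilCoproduct WeilPairing A2PlaneMonomials A2LamPowers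
  A2LamAdjoint A2CoproductMain A2HardLefschetzOps A2PontryaginModel A2ModelDuality
  A2PontryaginLefschetz

open scoped IsMulCommutative

variable {ι : Type*} [DecidableEq ι] [Fintype ι]

/-- `∫_B E_T ∧ E_S = vol` if `S = univ ∖ T`, and `0` otherwise. -/
theorem integral_ET_mul_ET (T S : Finset ι) :
    integral (ET T * ET S) = if S = Finset.univ \ T then vol ι else 0 := by
  by_cases hd : Disjoint T S
  · rw [← ET_union hd]
    by_cases hS : S = Finset.univ \ T
    · rw [if_pos hS, hS, Finset.union_sdiff_of_subset (Finset.subset_univ T), vol]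
    · rw [if_neg hS, ET_eq_mono]
      apply integral_mono_eq_zero
      right
      have hne : T ∪ S ≠ Finset.univ := by
        intro h
        apply hS
        rw [← h, Finset.union_sdiff_cancel_left hd]
      obtain ⟨p, hp⟩ : ∃ p, p ∉ T ∪ S :=
        not_forall.1 fun h => hne (Finset.eq_univ_iff_forall.2 h)
      exact ⟨(p, false), fun h => hp (mem_planeList.1 h)⟩
  · rw [ET_mul_ET_of_not_disjoint hd, map_zero, if_neg]
    intro hS
    exact hd (hS ▸ Finset.disjoint_sdiff)

/-- `II (inl z * inr (E_T) * x ⊗ y) = ∫_B z ∧ x · ∫_B E_T ∧ y`. -/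
lemma II_pair_ET_tmul (z : A ι) (T : Finset ι) (x y : A ι) :
    II (inl z * inr (ET T) * x ᵍ⊗ₜ[ℂ] y) = integral (z * x) * integral (ET T * y) := by
  rw [mul_assoc, inr_ET_mul_tmul, inl_mul_tmul, II_tmul]

/-- Half-plane tensors are killed by `II (inl z * inr (E_T) * ·)`: `E_T` times a half-plane
monomial is zero (`q ∈ T`) or a monomial missing a generator (`q ∉ T`). -/
theorem II_pair_ET_K_empty_eq_zero (Q : Finset ι) (z : A ι) (T : Finset ι) {Z : AA ι}
    (hZ : Z ∈ K Q ∅) : II (inl z * inr (ET T) * Z) = 0 := by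
  induction hZ using Submodule.span_induction with
  | mem Z hZ =>
    obtain ⟨x, y, hy, rfl⟩ := hZ
    rcases hy with ⟨q, _, b, l, hl, rfl⟩ | ⟨T', hT', _⟩
    · rw [II_pair_ET_tmul]
      by_cases hq : q ∈ T
      · rw [← mul_assoc, ET_mul_gen_of_mem hq, zero_mul, map_zero, mul_zero]
      · have hmono : ET T * (gen (q, b) * mono l) = mono (planeList T ++ (q, b) :: l) := by
          rw [mono_append, ET_eq_mono]
          simp [mono]
        rw [hmono, integral_mono_eq_zero, mul_zero]
        right
        refine ⟨(q, !b), ?_⟩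
        intro h
        rcases List.mem_append.1 h with h | h
        · exact hq (mem_planeList.1 h)
        · rcases List.mem_cons.1 h with h | h
          · exact Bool.not_ne_self b (Prod.mk.inj h).2
          · exact hl _ h rfl
    · exact absurd hT' (Finset.not_ssubset_empty T')
  | zero => simp
  | add Z Z' _ _ hZ hZ' => rw [mul_add, map_add, hZ, hZ', add_zero]
  | smul r Z _ hZ => rw [mul_smul_comm, map_smul, hZ, smul_zero]

/-- The pairing of `inl z * inr (E_T)` against the coproduct of a plane-sorted monomial: only
`S = univ ∖ T` survives. -/
theorem II_pair_ET_cop_planeProd {L : List ι} (hL : L.Nodup) (m : ι → Bool × Bool) (z : A ι)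
    (T : Finset ι) :
    II (inl z * inr (ET T) * cop (planeProd L m)) =
      if Finset.univ \ T ⊆ Eplanes L m then
        vol ι * integral (z * planeProd L (eraseS m (Finset.univ \ T))) else 0 := by
  have h := II_pair_ET_K_empty_eq_zero L.toFinset z T (cop_planeProd_sub_mainPart_mem hL m)
  rw [mul_sub, map_sub, sub_eq_zero] at h
  rw [h]
  simp only [mainPart, Finset.mul_sum, map_sum, II_pair_ET_tmul, integral_ET_mul_ET, mul_ite,
    mul_zero]
  rw [← Finset.sum_filter]
  by_cases hT : Finset.univ \ T ⊆ Eplanes L m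
  · rw [if_pos hT]
    have hfilter : (Eplanes L m).powerset.filter (fun S => S = Finset.univ \ T) =
        {Finset.univ \ T} := by
      ext S
      simp only [Finset.mem_filter, Finset.mem_powerset, Finset.mem_singleton]
      constructor
      · exact fun h => h.2
      · rintro rfl; exact ⟨hT, rfl⟩
    rw [hfilter, Finset.sum_singleton, mul_comm]
  · rw [if_neg hT]
    apply Finset.sum_eq_zero
    intro S hS
    rw [Finset.mem_filter, Finset.mem_powerset] at hS
    exact absurd (hS.2 ▸ hS.1) hT

/-- `Λ_S` on a plane-sorted monomial over the full list of planes. -/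
lemma lamS_planeProd_univ (S : Finset ι) (m : ι → Bool × Bool) :
    lamS S (planeProd Finset.univ.toList m) =
      if S ⊆ Eplanes Finset.univ.toList m then planeProd Finset.univ.toList (eraseS m S) else 0 := by
  rw [lamS_planeProd (Finset.nodup_toList _)]
  congr 1
  apply propext
  constructor
  · intro h p hp
    exact mem_Eplanes.2 (h p hp)
  · intro h p hp
    exact mem_Eplanes.1 (h hp)

omit [DecidableEq ι] [Fintype ι] in
/-- `Λ_p` and `Λ_S` commute (both lie in the commutative subalgebra `lamAlg`). -/
lemma lamAt_mul_lamS_comm (p : ι) (S : Finset ι) : lamAt p * lamS S = lamS S * lamAt p := by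
  have h : (lamEl p * ∏ q ∈ S, lamEl q : lamAlg ι) = (∏ q ∈ S, lamEl q) * lamEl p := mul_comm _ _
  have h' := congrArg (fun x : lamAlg ι => (x : Module.End ℂ (A ι))) h
  simpa only [Subalgebra.coe_mul, lamS, lamEl] using h'

/-- **`Λ_S` is self-adjoint for the Poincaré pairing** (a product of the self-adjoint `Λ_p`). -/
theorem integral_lamS_mul (S : Finset ι) (z u : A ι) :
    integral (lamS S z * u) = integral (z * lamS S u) := by
  induction S using Finset.induction_on generalizing z u with
  | empty => simp
  | insert p S hp ih =>
    rw [lamS_insert hp, Module.End.mul_apply, integral_lamAt_mul, ih, lamAt_mul_lamS_comm,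
      Module.End.mul_apply]

/-- The pairing identity on plane-sorted monomials:
`∫_B (z ⋆ E_T) ∧ u = vol · ∫_B z ∧ Λ_{univ∖T} u`. -/
theorem integral_pontryagin_ET_mul_planeProd (z : A ι) (T : Finset ι) (m : ι → Bool × Bool) :
    integral (pontryagin z (ET T) * planeProd Finset.univ.toList m) =
      vol ι * integral (z * lamS (Finset.univ \ T) (planeProd Finset.univ.toList m)) := by
  rw [integral_pontryagin_mul, II_pair_ET_cop_planeProd (Finset.nodup_toList _), lamS_planeProd_univ]
  split_ifs <;> simp

/-- The pairing identity for every `u`, by the monomial basis. -/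
theorem integral_pontryagin_ET_mul (z : A ι) (T : Finset ι) (u : A ι) :
    integral (pontryagin z (ET T) * u) = vol ι * integral (z * lamS (Finset.univ \ T) u) := by
  have key : (integral ∘ₗ LinearMap.mulLeft ℂ (pontryagin z (ET T))) =
      vol ι • (integral ∘ₗ LinearMap.mulLeft ℂ z ∘ₗ lamS (Finset.univ \ T)) := by
    refine aBasis.ext fun s => ?_
    obtain ⟨ε, -, hε⟩ := exists_sign_aBasis s
    simp only [LinearMap.comp_apply, LinearMap.mulLeft_apply, LinearMap.smul_apply, hε, map_smul,
      smul_eq_mul]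
    rw [integral_pontryagin_ET_mul_planeProd]
  have := LinearMap.congr_fun key u
  simpa using this

/-- **THE PONTRYAGIN PRODUCT WITH A FULL-PLANE MONOMIAL IS A PLANE CONTRACTION**:
`z ⋆ E_T = vol • Λ_{univ ∖ T} z` for every `z` and every set `T` of planes. -/
theorem pontryagin_ET (z : A ι) (T : Finset ι) :
    pontryagin z (ET T) = vol ι • lamS (Finset.univ \ T) z := by
  symm
  apply pontryagin_unique
  intro u
  rw [← integral_pontryagin_mul, smul_mul_assoc, map_smul, smul_eq_mul, integral_lamS_mul,
    integral_pontryagin_ET_mul]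

/-- The Pontryagin product is linear in the right factor (from its definition as a dual). -/
lemma pontryagin_add_right (z a b : A ι) :
    pontryagin z (a + b) = pontryagin z a + pontryagin z b := by
  symm
  apply pontryagin_unique
  intro u
  rw [add_mul, map_add, integral_pontryagin_mul, integral_pontryagin_mul, map_add, mul_add, add_mul,
    map_add]

/-- The Pontryagin product is homogeneous in the right factor. -/
lemma pontryagin_smul_right (r : ℂ) (z a : A ι) :
    pontryagin z (r • a) = r • pontryagin z a := by
  symm
  apply pontryagin_unique
  intro u
  rw [smul_mul_assoc, map_smul, integral_pontryagin_mul, map_smul, mul_smul_comm, smul_mul_assoc,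
    map_smul]

/-- The Pontryagin product with a finite sum of right factors. -/
lemma pontryagin_sum_right {α : Type*} (z : A ι) (s : Finset α) (f : α → A ι) :
    pontryagin z (∑ i ∈ s, f i) = ∑ i ∈ s, pontryagin z (f i) := by
  induction s using Finset.cons_induction with
  | empty =>
    simp only [Finset.sum_empty]
    symm
    apply pontryagin_unique
    intro u
    simp
  | cons i s hi ih => rw [Finset.sum_cons, Finset.sum_cons, pontryagin_add_right, ih]

/-- **The Pontryagin product with an element of the `E`-subalgebra is a constant-coefficient
contraction operator**: `z ⋆ (Σ_T a_T E_T) = Σ_T a_T vol • Λ_{univ ∖ T} z`. -/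
theorem pontryagin_sum_ET (z : A ι) (s : Finset (Finset ι)) (a : Finset ι → ℂ) :
    pontryagin z (∑ T ∈ s, a T • ET T) = ∑ T ∈ s, (a T * vol ι) • lamS (Finset.univ \ T) z := by
  rw [pontryagin_sum_right]
  refine Finset.sum_congr rfl fun T _ => ?_
  rw [pontryagin_smul_right, pontryagin_ET, smul_smul]

/-- **The operator identity from the full-plane formula**: with p5's `θ^k = k! Σ_{|T| = k} c_T E_T`,
`z ⋆ θ^k = k! vol Σ_{|T| = k} c_T • Λ_{univ ∖ T} z`. -/
theorem pontryagin_theta_pow_eq_sum (z : A ι) (c : ι → ℂ) (k : ℕ) :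
    pontryagin z (theta c ^ k) =
      ∑ T ∈ Finset.powersetCard k Finset.univ,
        ((k.factorial : ℂ) * (∏ p ∈ T, c p) * vol ι) • lamS (Finset.univ \ T) z := by
  rw [theta_pow, pontryagin_smul_right, pontryagin_sum_ET, Finset.smul_sum]
  refine Finset.sum_congr rfl fun T _ => ?_
  rw [smul_smul, mul_assoc]

end Summit.Ventures.HodgeRepro2.A2PontryaginFullPlane
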